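import Summits.AtomisticToContinuum.Crystallization.Theorems.ChargedEnergyGapLabelledCovering
import HarnessLib

/-!
# Charged energy gap — lens-3 g63, part P-Z₅a: the KISSING CLUSTER — thirteen distinct sites within `8/5` of every site of a labelled reference

Cell `decomp-a2c`, seat lens-3, generation 63, part P-Z₅a (after P-Z₁ `ChargedEnergyGapLabelledCovering`).  ELEMENTARY·PROVED.
The fair-share attribution of the bulk far residue (seat HANDOFF §J (J3)) divides a pair's load among the DISTINCT sites available near
each passage point; P-Z₁'s covering radius `219/100` alone yields one site per point.  Here the local CLUSTER is typed: every site
`(k, i, j)` of a Barlow stacking `barlowPos a h s` with Hägg sequence `s` has twelve nearest neighbours — six in its layer at distance `a`,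
three in each adjacent layer at distance `√(a²/3 + h²)` (lateral offsets `s k • w`, `−s (k−1) • w`; `haggLabel_succ`, `dist_barlowPos_sq`)
— all within `6/5` on the coherence window `a ≤ 11/10`, `h² ≤ 121/150·a²` (`kissIdx`, `kissPos`, `kissPos_injective`,
`dist_kissPos_le`); an isometric image and a label map of discrete strain `lam < 1` within reach `ℓ ≥ 6/5` carry them to twelve
pairwise distinct configuration points other than the labelled point, within `(1 + lam)·6/5` of it (`LabelledWithin.exists_twelve_near`,
by `dist_labels_le`).  Record (`lam ≤ 1/3`, `ℓ ≥ 3`): ★ every SITE of a labelled reference has `12` other sites within `8/5`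
(`IsLabelledRef.exists_twelve_near`, by translation from the motif), ★★ `13` pairwise distinct sites within `8/5`
(`IsLabelledRef.exists_thirteen_near`), and ★ every POINT of space has `13` pairwise distinct sites within `379/100 = 219/100 + 8/5`
(`IsLabelledRef.exists_thirteen_near_point`, with P-Z₁'s covering).  No separation, force or stress hypothesis is used.
-/

noncomputable section

open scoped Classical

open Literature.MathematicalPhysics.StatisticalMechanics Literature.Geometry.DiscreteGeometry
open Summit.AtomisticToContinuum.Crystallization.Theses.PricedLinkCensus
open Summit.AtomisticToContinuum.Crystallization.Theorems.ChargedEnergyGapNegative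

namespace Summit.AtomisticToContinuum.Crystallization.Theorems.ChargedEnergyGapChartDial

/-! ## §1 The twelve neighbours in a Barlow stacking -/

section Barlow

variable (a h : ℝ) (s : ℤ → ℤ)

/-- The index triples `(layer, i, j)` of the twelve nearest neighbours of the site `(k, i, j)`: six in the layer, three in the layer above
(lateral offset `s k • w`), three in the layer below (lateral offset `−s (k − 1) • w`). [formal bookkeeping] -/
def kissIdx (k i j : ℤ) : Fin 12 → ℤ × ℤ × ℤ :=
  ![(k, i + 1, j), (k, i - 1, j), (k, i, j + 1), (k, i, j - 1), (k, i + 1, j - 1), (k, i - 1, j + 1),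
    (k + 1, i, j), (k + 1, i - s k, j), (k + 1, i, j - s k),
    (k - 1, i, j), (k - 1, i + s (k - 1), j), (k - 1, i, j + s (k - 1))]

/-- The twelve nearest neighbours of `barlowPos a h s k i j`, as points. [formal bookkeeping] -/
def kissPos (k i j : ℤ) (m : Fin 12) : E3 :=
  barlowPos a h s (kissIdx s k i j m).1 (kissIdx s k i j m).2.1 (kissIdx s k i j m).2.2

variable {s}

/-- The twelve index triples are pairwise distinct (a Hägg sequence takes the values `±1`). [formal bookkeeping] -/
theorem kissIdx_injective (hs : IsHaggSeq s) (k i j : ℤ) : Function.Injective (kissIdx s k i j) := by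
  have hk := hs k
  have hk' := hs (k - 1)
  intro m m' hmm
  fin_cases m <;> fin_cases m' <;> simp [kissIdx] at hmm ⊢ <;> omega

/-- None of the twelve index triples is the centre `(k, i, j)`. [formal bookkeeping] -/
theorem kissIdx_ne_centre (hs : IsHaggSeq s) (k i j : ℤ) (m : Fin 12) : kissIdx s k i j m ≠ (k, i, j) := by
  have hk := hs k
  have hk' := hs (k - 1)
  fin_cases m <;> simp [kissIdx]

variable {a h}

/-- The twelve neighbours are pairwise distinct points (`a, h > 0`). -/
theorem kissPos_injective (ha : 0 < a) (hh : 0 < h) (hs : IsHaggSeq s) (k i j : ℤ) : Function.Injective (kissPos a h s k i j) := by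
  intro m m' hmm
  by_contra hne
  have hidx : ((kissIdx s k i j m).1, (kissIdx s k i j m).2.1, (kissIdx s k i j m).2.2) ≠
      ((kissIdx s k i j m').1, (kissIdx s k i j m').2.1, (kissIdx s k i j m').2.2) := by
    simpa only [Prod.mk.eta] using (kissIdx_injective hs k i j).ne hne
  have h1 : min a h ≤ dist (kissPos a h s k i j m) (kissPos a h s k i j m') := le_dist_barlowPos a h s ha.le hh.le hidx
  rw [hmm, dist_self] at h1
  exact absurd h1 (not_le.2 (lt_min ha hh))

/-- None of the twelve neighbours is the centre (`a, h > 0`). -/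
theorem kissPos_ne_centre (ha : 0 < a) (hh : 0 < h) (hs : IsHaggSeq s) (k i j : ℤ) (m : Fin 12) :
    kissPos a h s k i j m ≠ barlowPos a h s k i j := by
  intro heq
  have hidx : ((kissIdx s k i j m).1, (kissIdx s k i j m).2.1, (kissIdx s k i j m).2.2) ≠ (k, i, j) := by
    simpa only [Prod.mk.eta] using kissIdx_ne_centre hs k i j m
  have h1 : min a h ≤ dist (kissPos a h s k i j m) (barlowPos a h s k i j) := le_dist_barlowPos a h s ha.le hh.le hidx
  rw [heq, dist_self] at h1
  exact absurd h1 (not_le.2 (lt_min ha hh))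

/-- In-layer squared distances: `|Δi u + Δj v|² = a²(Δi² + Δi Δj + Δj²)`. [formal bookkeeping] -/
theorem dist_sq_sameLayer (k i j i' j' : ℤ) : dist (barlowPos a h s k i' j') (barlowPos a h s k i j) ^ 2 =
    a ^ 2 * (((i' : ℝ) - i) ^ 2 + ((i' : ℝ) - i) * ((j' : ℝ) - j) + ((j' : ℝ) - j) ^ 2) := by
  have h3 : (√3 : ℝ) ^ 2 = 3 := Real.sq_sqrt (by norm_num)
  rw [dist_barlowPos_sq]
  linear_combination (a ^ 2 * ((j' : ℝ) - j) ^ 2 / 4) * h3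

/-- Squared distances to the layer above (label offset `s k = ±1`). [formal bookkeeping] -/
theorem dist_sq_succLayer (hs : IsHaggSeq s) (k i j i' j' : ℤ) : dist (barlowPos a h s (k + 1) i' j') (barlowPos a h s k i j) ^ 2 =
    a ^ 2 * (((i' : ℝ) - i) ^ 2 + ((i' : ℝ) - i) * ((j' : ℝ) - j) + ((j' : ℝ) - j) ^ 2 + (((i' : ℝ) - i) + ((j' : ℝ) - j)) * (s k : ℝ) +
      1 / 3) + h ^ 2 := by
  have h3 : (√3 : ℝ) ^ 2 = 3 := Real.sq_sqrt (by norm_num)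
  have hδ : ((s k : ℤ) : ℝ) ^ 2 = 1 := by rcases hs k with h0 | h0 <;> rw [h0] <;> norm_num
  rw [dist_barlowPos_sq, haggLabel_succ]
  push_cast
  linear_combination (a ^ 2 * (((j' : ℝ) - j) + (s k : ℝ) / 3) ^ 2 / 4) * h3 + (a ^ 2 / 3) * hδ

/-- Squared distances to the layer below (label offset `−s (k − 1) = ∓1`). [formal bookkeeping] -/
theorem dist_sq_predLayer (hs : IsHaggSeq s) (k i j i' j' : ℤ) : dist (barlowPos a h s (k - 1) i' j') (barlowPos a h s k i j) ^ 2 =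
    a ^ 2 * (((i' : ℝ) - i) ^ 2 + ((i' : ℝ) - i) * ((j' : ℝ) - j) + ((j' : ℝ) - j) ^ 2 - (((i' : ℝ) - i) + ((j' : ℝ) - j)) * (s (k - 1) : ℝ) +
      1 / 3) + h ^ 2 := by
  have h3 : (√3 : ℝ) ^ 2 = 3 := Real.sq_sqrt (by norm_num)
  have hδ : ((s (k - 1) : ℤ) : ℝ) ^ 2 = 1 := by rcases hs (k - 1) with h0 | h0 <;> rw [h0] <;> norm_num
  have hl : haggLabel s (k - 1) = haggLabel s k - s (k - 1) := by
    have := haggLabel_succ s (k - 1); rw [sub_add_cancel] at this; linarith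
  rw [dist_barlowPos_sq, hl]
  push_cast
  linear_combination (a ^ 2 * (((j' : ℝ) - j) - (s (k - 1) : ℝ) / 3) ^ 2 / 4) * h3 + (a ^ 2 / 3) * hδ

/-- ★ **THE TWELVE NEIGHBOURS ARE WITHIN `6/5`** on the coherence window: in-layer distance `a ≤ 11/10`, adjacent-layer distance
`√(a²/3 + h²) ≤ √(171/150 · 121/100) < 6/5`. -/
theorem dist_kissPos_le (ha : 9 / 10 ≤ a ∧ a ≤ 11 / 10) (hh : 0 < h ∧ 27 / 50 * a ^ 2 ≤ h ^ 2 ∧ h ^ 2 ≤ 121 / 150 * a ^ 2)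
    (hs : IsHaggSeq s) (k i j : ℤ) (m : Fin 12) : dist (kissPos a h s k i j m) (barlowPos a h s k i j) ≤ 6 / 5 := by
  have hA : a ^ 2 ≤ (6 / 5) ^ 2 := by nlinarith [ha.1, ha.2]
  have hB : a ^ 2 / 3 + h ^ 2 ≤ (6 / 5) ^ 2 := by nlinarith [ha.1, ha.2, hh.2.2]
  fin_cases m
  all_goals
    simp [kissPos, kissIdx]
    refine (pow_le_pow_iff_left₀ dist_nonneg (by norm_num) two_ne_zero).1 ?_
    first
      | (rw [dist_sq_sameLayer]; push_cast; ring_nf; ring_nf at hA; linarith)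
      | (rw [dist_sq_succLayer hs]; push_cast; ring_nf; ring_nf at hB; linarith)
      | (rw [dist_sq_predLayer hs]; push_cast; ring_nf; ring_nf at hB; linarith)

end Barlow

/-! ## §2 Transport through an isometric image and a label map -/

/-- ★ **TWELVE LABELLED NEIGHBOURS**: a point `p` Barlow-labelled within reach `ℓ ≥ 6/5` at discrete strain `lam < 1` has twelve pairwise
distinct configuration points other than `p` within `(1 + lam)·6/5` of it — the label images of the twelve nearest neighbours of its label. -/
theorem LabelledWithin.exists_twelve_near {lam ℓ : ℝ} {Q : PeriodicConfiguration 3} {p : E3} (hW : LabelledWithin lam ℓ Q p)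
    (hlam : lam < 1) (hℓ : 6 / 5 ≤ ℓ) :
    ∃ c : Fin 12 → E3, Function.Injective c ∧ ∀ m, c m ∈ Q.points ∧ c m ≠ p ∧ dist (c m) p ≤ (1 + lam) * (6 / 5) := by
  obtain ⟨S, hS, Φ, x₀, hx₀, hp, hlab, -, hstr⟩ := hW
  obtain ⟨a, h, s, g, ha, hh, hs, hg, rfl⟩ := hS
  obtain ⟨x₀', hx₀', rfl⟩ := hx₀
  obtain ⟨k, i, j, rfl⟩ := hx₀'
  have ha0 : 0 < a := by linarith [ha.1]
  -- the twelve neighbours, transported by `g`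
  set n : Fin 12 → E3 := fun m => g (kissPos a h s k i j m) with hn
  have hnS : ∀ m, n m ∈ g '' barlowStacking a h s := fun m => ⟨_, barlowPos_mem _ _ _, rfl⟩
  have hnd : ∀ m, dist (n m) (g (barlowPos a h s k i j)) ≤ 6 / 5 := fun m => by
    rw [hn, hg.dist_eq]; exact dist_kissPos_le ha hh hs k i j m
  have hnℓ : ∀ m, dist (n m) (g (barlowPos a h s k i j)) ≤ ℓ := fun m => (hnd m).trans hℓ
  have h0ℓ : dist (g (barlowPos a h s k i j)) (g (barlowPos a h s k i j)) ≤ ℓ := by rw [dist_self]; linarith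
  have hne : ∀ m, n m ≠ g (barlowPos a h s k i j) := fun m heq => kissPos_ne_centre ha0 hh.1 hs k i j m (hg.injective heq)
  have hninj : Function.Injective n := fun m m' heq => kissPos_injective ha0 hh.1 hs k i j (hg.injective heq)
  refine ⟨fun m => Φ (n m), fun m m' (heq : Φ (n m) = Φ (n m')) => ?_, fun m => ⟨hlab _ (hnS m) (hnℓ m), fun (heq : Φ (n m) = p) => ?_, ?_⟩⟩
  · -- distinct labels carry distinct points (`lam < 1`)
    by_contra hmm
    have h1 := dist_labels_le (hstr _ (hnS m) _ (hnS m') (hnℓ m) (hnℓ m'))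
    have h2 : Φ (n m) - Φ (n m') = 0 := sub_eq_zero.2 heq
    rw [h2, norm_zero] at h1
    have : 0 < (1 - lam) * ‖n m - n m'‖ := mul_pos (by linarith) (norm_pos_iff.2 (sub_ne_zero.2 (hninj.ne hmm)))
    linarith
  · have h1 := dist_labels_le (hstr _ (hnS m) _ ⟨_, barlowPos_mem k i j, rfl⟩ (hnℓ m) h0ℓ)
    rw [hp, heq, sub_self, norm_zero] at h1
    have : 0 < (1 - lam) * ‖n m - g (barlowPos a h s k i j)‖ := mul_pos (by linarith) (norm_pos_iff.2 (sub_ne_zero.2 (hne m)))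
    linarith
  · have hsm := hstr _ (hnS m) _ ⟨_, barlowPos_mem k i j, rfl⟩ (hnℓ m) h0ℓ
    rw [hp] at hsm
    have h2 := norm_add_le ((Φ (n m) - p) - (n m - g (barlowPos a h s k i j))) (n m - g (barlowPos a h s k i j))
    rw [sub_add_cancel] at h2
    rw [dist_eq_norm]
    have h3 : ‖n m - g (barlowPos a h s k i j)‖ ≤ 6 / 5 := by rw [← dist_eq_norm]; exact hnd m
    have hvpos : 0 < ‖n m - g (barlowPos a h s k i j)‖ := norm_pos_iff.2 (sub_ne_zero.2 (hne m))
    have hlam0 : 0 ≤ lam := by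
      by_contra hneg
      push Not at hneg
      have : lam * ‖n m - g (barlowPos a h s k i j)‖ < 0 := mul_neg_of_neg_of_pos hneg hvpos
      linarith [norm_nonneg ((Φ (n m) - p) - (n m - g (barlowPos a h s k i j)))]
    calc ‖Φ (n m) - p‖ ≤ ‖(Φ (n m) - p) - (n m - g (barlowPos a h s k i j))‖ + ‖n m - g (barlowPos a h s k i j)‖ := h2
      _ ≤ (1 + lam) * ‖n m - g (barlowPos a h s k i j)‖ := by linarith
      _ ≤ (1 + lam) * (6 / 5) := mul_le_mul_of_nonneg_left h3 (by linarith)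

/-! ## §3 ★ Record: thirteen sites within `8/5` of every site, within `379/100` of every point -/

section Record

variable {lam ℓ : ℝ} {P : PeriodicConfiguration 3}

/-- ★ **TWELVE OTHER SITES WITHIN `8/5` OF EVERY SITE** of a `(lam ≤ 1/3, ℓ ≥ 3)`-labelled reference (translation from the motif). -/
theorem IsLabelledRef.exists_twelve_near (hL : IsLabelledRef lam ℓ P) (hlam : lam ≤ 1 / 3) (hℓ : 3 ≤ ℓ) {y : E3} (hy : y ∈ P.points) :
    ∃ c : Fin 12 → E3, Function.Injective c ∧ ∀ m, c m ∈ P.points ∧ c m ≠ y ∧ dist (c m) y ≤ 8 / 5 := by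
  obtain ⟨q, hq, g, hg, rfl⟩ := hy
  obtain ⟨c, hc, hcm⟩ := (hL q hq).exists_twelve_near (by linarith) (by linarith)
  refine ⟨fun m => c m + g, fun m m' heq => hc (add_right_cancel heq), fun m => ⟨P.add_mem_points (hcm m).1 hg, fun heq => ?_, ?_⟩⟩
  · exact (hcm m).2.1 (add_right_cancel heq)
  · rw [dist_add_right]
    refine ((hcm m).2.2).trans ?_
    nlinarith

/-- ★★ **THIRTEEN DISTINCT SITES WITHIN `8/5` OF EVERY SITE** (the site and its twelve labelled neighbours). -/
theorem IsLabelledRef.exists_thirteen_near (hL : IsLabelledRef lam ℓ P) (hlam : lam ≤ 1 / 3) (hℓ : 3 ≤ ℓ) {y : E3} (hy : y ∈ P.points) :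
    ∃ c : Fin 13 → E3, Function.Injective c ∧ ∀ m, c m ∈ P.points ∧ dist (c m) y ≤ 8 / 5 := by
  obtain ⟨c, hc, hcm⟩ := hL.exists_twelve_near hlam hℓ hy
  refine ⟨Fin.cons y c, Fin.cons_injective_iff.2 ⟨?_, hc⟩, fun m => ?_⟩
  · rintro ⟨m, hm⟩
    exact (hcm m).2.1 hm
  · refine Fin.cases ?_ (fun m => ?_) m
    · refine ⟨by simpa using hy, ?_⟩
      simp only [Fin.cons_zero, dist_self]
      norm_num
    · simpa using ⟨(hcm m).1, (hcm m).2.2⟩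

/-- ★ **THIRTEEN DISTINCT SITES WITHIN `379/100` OF EVERY POINT OF SPACE** (P-Z₁'s covering radius `219/100`, then the cluster). -/
theorem IsLabelledRef.exists_thirteen_near_point (hL : IsLabelledRef lam ℓ P) (hlam : lam ≤ 1 / 3) (hℓ : 3 ≤ ℓ) (w : E3) :
    ∃ c : Fin 13 → E3, Function.Injective c ∧ ∀ m, c m ∈ P.points ∧ dist w (c m) ≤ 379 / 100 := by
  obtain ⟨y, hy, hwy⟩ := hL.exists_dist_le hlam hℓ w
  obtain ⟨c, hc, hcm⟩ := hL.exists_thirteen_near hlam hℓ hy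
  refine ⟨c, hc, fun m => ⟨(hcm m).1, ?_⟩⟩
  calc dist w (c m) ≤ dist w y + dist y (c m) := dist_triangle _ _ _
    _ ≤ 219 / 100 + 8 / 5 := add_le_add hwy (by rw [dist_comm]; exact (hcm m).2)
    _ = 379 / 100 := by norm_num

/-- Record numerals: the window's adjacent-layer bound `171/150 · 121/100 < (6/5)²`, the cluster radius `(1 + 1/3)·6/5 = 8/5`, and
`219/100 + 8/5 = 379/100`. -/
theorem record_kissing_numerals : (171 : ℝ) / 150 * (121 / 100) < (6 / 5) ^ 2 ∧ (1 + (1 : ℝ) / 3) * (6 / 5) = 8 / 5 ∧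
    (219 : ℝ) / 100 + 8 / 5 = 379 / 100 := by
  refine ⟨by norm_num, by norm_num, by norm_num⟩

end Record

end Summit.AtomisticToContinuum.Crystallization.Theorems.ChargedEnergyGapChartDial

end
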